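import Literature.NumberTheory.EllipticCurves.NonvanishingTwistsPrescribedRamificationOfHoffsteinLuoProofs
import Literature.NumberTheory.EllipticCurves.LFunctionSmulProofs
import HarnessLib

/-!
# The rank-one field supply with `2` RAMIFIED, from the dyadic root-number engine and Hoffstein–Luo 1997
# (crux `AdditiveBranchIMC.GordTwoRankOne`, line `wan_tame_bdp_road` v23, stub `stub_fieldOneDyadicWan : EngineTwo → FieldOneTwo`)

Theorems-side file (theorems only; no definition, no named fact, no `sorry`): the `q = 2` companion of
`exists_ramifiedAt_splitAt_twist_ne_zero_of_rootNumber_twist` (`NonvanishingTwistsPrescribedRamificationOfHoffsteinLuoProofs`, F5 with ONE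
ramified odd prime `q`) and of p761092's `TwistRowRankOneClosedHL.exists_ramifiedAt_splitAt_twist_ne_zero_twistAny`. GIVEN the root-number
engine `w(E^{(2ℓ)}) = w(E)` (hypothesis `hE`, literally the body of the skeleton's `EngineTwo`; discharged by
`TwistRootNumberDyadic.rootNumber_quadraticTwist_two_mul_eq_of_nonsplit_two`), for `E / ℚ` (globally minimal `W`, modular, odd additive
primes of quadratic-twist type, NON-SPLIT multiplicative at `2`) with `w(E) = −1`, an odd prime `p` and a bound `B`: an imaginary quadratic
`K` with `|d_K| > B`, `2 ∣ d_K`, every ODD prime of `N_E` split in `K`, `p` split, and `L(E^{(d_K)}, 1) ≠ 0`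
(`fieldOneTwo_of_engineTwo`, literally `EngineTwo → FieldOneTwo`).

ROAD (the print road R2 of Friedberg–Hoffstein's Theorem B with the ramified prime `q = 2`): a Dirichlet prime `ℓ₁ ≡ 2 + 7M² (mod 8M)`,
`M = p·∏_{r ∣ N_E odd} r` — so `ℓ₁ ≡ 1 (mod 8)` and `ℓ₁ ≡ 2 (mod r)`, whence `(2ℓ₁ / r) = (4 / r) = 1` — (§1); `E₀ = E^{(2ℓ₁)}` has
`w(E₀) = w(E) = −1` by the engine; Hoffstein–Luo with the sign obstruction (`exists_neg_fundamental_twist_ne_zero_of_hoffsteinLuo`) gives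
`d < 0` squarefree, `d ≡ 1 (mod 8)`, `(d / r) = 1` at `r ∈ {p, ℓ₁} ∪ {r ∣ N_E odd}`, `L(E₀^{(d)}, 1) ≠ 0`; the composite discriminant
`D = 8ℓ₁d = 4·(2ℓ₁d)` is fundamental of the EVEN kind (`2ℓ₁d ≡ 2 (mod 4)` squarefree) with `(D / r) = (4/r)(2ℓ₁/r)(d/r) = 1` at the
primes of the ODD level `N₁ = p·∏_{r ∣ N_E odd} r`, so the dictionary `exists_heegnerField_iff_exists_fundamental` produces `K = ℚ(√D)`;
finally `E^{(D)} = E^{(4·2ℓ₁d)} ≅ E^{(2ℓ₁d)} = E₀^{(d)}` (`exists_variableChange_quadraticTwist_mul_sq`, `entireLFunction_smul`).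

* `exists_prime_emod_eight_eq_one_jacobiSym_two_mul_eq_one` — the auxiliary prime (§1);
* `fieldOneTwo_of_engineTwo` — **`EngineTwo → FieldOneTwo`** (§2).

BSD is proved for no curve by any of this.
References: [HoffsteinLuo1997] Theorem (§1, pp. 435–436); [FriedbergHoffstein1995] Thm. B; [CastellaWan2023] proof of Thm. 6.11 (MS p. 33)
(a)–(e); [MurtyMurty1997] Ch. 6 §1.
-/

set_option linter.dupNamespace false
set_option autoImplicit false

noncomputable section

open scoped Classical

open WeierstrassCurve IsDedekindDomain NumberField Rat.HeightOneSpectrum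
  Literature.NumberTheory.EllipticCurves Literature.NumberTheory.EllipticCurves.ModularForms

namespace Summit.BirchSwinnertonDyer.BirchSwinnertonDyer.Theorems.TwistRootNumberDyadic

/-! ### §1 The auxiliary prime `ℓ ≡ 1 (mod 8)`, `ℓ ≡ 2 (mod r)` (Dirichlet) -/

/-- **An auxiliary prime** `ℓ > B` with `ℓ ≡ 1 (mod 8)` and `(2ℓ / p) = 1` at the odd primes `p ∈ S`: `ℓ ≡ 2 + 7M² (mod 8M)` with
`M = ∏_{p ∈ S prime, p ≠ 2} p` (Dirichlet, `Nat.forall_exists_prime_gt_and_zmodEq`), so that `ℓ ≡ 1 (mod 8)` (`M² ≡ 1`) and `ℓ ≡ 2 (mod p)`,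
`(2ℓ / p) = (2/p)² = 1`. [folklore] -/
theorem exists_prime_emod_eight_eq_one_jacobiSym_two_mul_eq_one (S : Finset ℕ) (B : ℕ) :
    ∃ ℓ : ℕ, ℓ.Prime ∧ B < ℓ ∧ (ℓ : ℤ) % 8 = 1 ∧
      ∀ p ∈ S, p.Prime → p ≠ 2 → jacobiSym ((2 : ℤ) * ℓ) p = 1 := by
  set T : Finset ℕ := (S.filter fun p ↦ p.Prime ∧ p ≠ 2) with hT
  set M : ℕ := ∏ p ∈ T, p with hM
  have hTprime : ∀ p ∈ T, p.Prime := fun p hp ↦ (Finset.mem_filter.mp hp).2.1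
  have hTodd : ∀ p ∈ T, p ≠ 2 := fun p hp ↦ (Finset.mem_filter.mp hp).2.2
  have hM0 : M ≠ 0 := Finset.prod_ne_zero_iff.mpr fun p hp ↦ (hTprime p hp).ne_zero
  have hModd : M % 2 = 1 := by
    have h : ¬ 2 ∣ M := by
      intro h2
      obtain ⟨p, hp, h2p⟩ := (Nat.prime_two.prime.dvd_finsetProd_iff (fun i ↦ i)).mp h2
      exact hTodd p hp ((Nat.prime_dvd_prime_iff_eq Nat.prime_two (hTprime p hp)).mp h2p).symm
    omega
  set m : ℕ := 8 * M with hm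
  have hm0 : m ≠ 0 := mul_ne_zero (by norm_num) hM0
  set c : ℕ := 2 + 7 * M ^ 2 with hc
  -- `c` is odd and `≡ 2 (mod p)` for `p ∣ M`
  have hM2odd : M ^ 2 % 2 = 1 := by rw [Nat.pow_mod, hModd]
  have hcodd : c % 2 = 1 := by omega
  have hcop : Nat.Coprime c m := by
    rw [hm]
    refine Nat.Coprime.mul_right ?_ ?_
    · have h2 : Nat.Coprime c 2 := ((Nat.Prime.coprime_iff_not_dvd Nat.prime_two).mpr (by omega)).symm
      simpa using h2.pow_right 3
    · refine Nat.Coprime.prod_right fun p hp ↦ ((Nat.Prime.coprime_iff_not_dvd (hTprime p hp)).mpr ?_).symm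
      intro hpc
      have hpM : p ∣ M := Finset.dvd_prod_of_mem (fun i ↦ i) hp
      have hp7 : p ∣ 7 * M ^ 2 := (hpM.trans (dvd_pow_self M two_ne_zero)).mul_left 7
      have hp2 : p ∣ c - 7 * M ^ 2 := Nat.dvd_sub hpc hp7
      rw [show c - 7 * M ^ 2 = 2 by omega] at hp2
      exact hTodd p hp ((Nat.prime_dvd_prime_iff_eq (hTprime p hp) Nat.prime_two).mp hp2)
  obtain ⟨ℓ, hℓB, hℓ, hℓmod⟩ := Nat.forall_exists_prime_gt_and_zmodEq (max B 2) hm0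
    (Nat.isCoprime_iff_coprime.mpr hcop)
  have hℓB' : B < ℓ := lt_of_le_of_lt (le_max_left _ _) hℓB
  refine ⟨ℓ, hℓ, hℓB', ?_, ?_⟩
  · -- `ℓ ≡ c = 2 + 7M² ≡ 1 (mod 8)`
    have h8m : (8 : ℤ) ∣ (m : ℤ) := by rw [hm]; push_cast; exact dvd_mul_right _ _
    have h8 : (ℓ : ℤ) ≡ (c : ℕ) [ZMOD 8] := hℓmod.of_dvd h8m
    have hM8 : M ^ 2 % 8 = 1 := by
      have hr : M % 8 = 1 ∨ M % 8 = 3 ∨ M % 8 = 5 ∨ M % 8 = 7 := by omega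
      rcases hr with h | h | h | h <;> rw [Nat.pow_mod, h]
    have hc8 : (c : ℤ) % 8 = 1 := by
      have : c % 8 = 1 := by omega
      exact_mod_cast this
    rw [Int.ModEq] at h8
    rw [h8, hc8]
  · intro p hpS hp hp2
    have hpT : p ∈ T := Finset.mem_filter.mpr ⟨hpS, hp, hp2⟩
    have hpM : p ∣ M := Finset.dvd_prod_of_mem (fun i ↦ i) hpT
    have hpm : (p : ℤ) ∣ (m : ℤ) := by
      rw [hm]; exact Int.natCast_dvd_natCast.mpr (hpM.mul_left 8)
    have hmodp : (ℓ : ℤ) ≡ (c : ℕ) [ZMOD p] := hℓmod.of_dvd hpm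
    have hc2 : ((c : ℕ) : ℤ) ≡ 2 [ZMOD p] := by
      rw [Int.modEq_iff_dvd, hc]
      push_cast
      have h : (p : ℤ) ∣ (M : ℤ) ^ 2 := (Int.natCast_dvd_natCast.mpr hpM).trans (dvd_pow_self _ two_ne_zero)
      rw [show (2 : ℤ) - (2 + 7 * (M : ℤ) ^ 2) = (-7) * (M : ℤ) ^ 2 by ring]
      exact h.mul_left _
    have hℓ2 : (ℓ : ℤ) ≡ 2 [ZMOD p] := hmodp.trans hc2
    have hgcd : Int.gcd (2 : ℤ) p = 1 := by
      rw [show (2 : ℤ) = ((2 : ℕ) : ℤ) by rfl, Int.gcd_natCast_natCast]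
      exact (Nat.coprime_primes Nat.prime_two hp).mpr (Ne.symm hp2)
    rw [jacobiSym.mod_left, show ((2 : ℤ) * ℓ) % (p : ℕ) = ((2 : ℤ) * 2) % (p : ℕ) from
      (hℓ2.mul_left (2 : ℤ)), ← jacobiSym.mod_left, jacobiSym.mul_left, ← sq, jacobiSym.sq_one hgcd]

/-- `(a / b) = 1` forces `gcd(a, b) = 1`. [folklore] -/
private theorem isCoprime_of_jacobiSym_eq_one' {a : ℤ} {b : ℕ} (hb : b ≠ 0) (h : jacobiSym a b = 1) :
    IsCoprime a (b : ℤ) := by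
  refine Int.isCoprime_iff_gcd_eq_one.mpr ?_
  by_contra hg
  rw [jacobiSym.eq_zero_iff.mpr ⟨hb, hg⟩] at h
  exact zero_ne_one h

/-- Every odd prime of `N` divides `∏_{r ∣ N, r ≠ 2} r`. [folklore] -/
private theorem dvd_prod_primeFactors_erase_two {N r : ℕ} (hN : N ≠ 0) (hr : r.Prime) (hrN : r ∣ N) (hr2 : r ≠ 2) :
    r ∣ ∏ i ∈ N.primeFactors.erase 2, i :=
  Finset.dvd_prod_of_mem (fun i ↦ i) (Finset.mem_erase.mpr ⟨hr2, Nat.mem_primeFactors.mpr ⟨hr, hrN, hN⟩⟩)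

/-- A prime dividing `∏_{r ∣ N, r ≠ 2} r` is an odd prime of `N`. [folklore] -/
private theorem mem_of_dvd_prod_primeFactors_erase_two {N r : ℕ} (hr : r.Prime)
    (h : r ∣ ∏ i ∈ N.primeFactors.erase 2, i) : r ∣ N ∧ r ≠ 2 := by
  obtain ⟨i, hi, hri⟩ := ((Nat.Prime.prime hr).dvd_finsetProd_iff (fun i ↦ i)).mp h
  obtain ⟨hi2, hiN⟩ := Finset.mem_erase.mp hi
  have hip := Nat.mem_primeFactors.mp hiN
  have hri' : r = i := (Nat.prime_dvd_prime_iff_eq hr hip.1).mp hri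
  subst hri'
  exact ⟨hip.2.1, hi2⟩

/-! ### §2 `EngineTwo → FieldOneTwo`: Friedberg–Hoffstein's F5 with the RAMIFIED prime `2` -/

/-- **The rank-one field supply with `2` ramified, from the dyadic root-number engine** (`EngineTwo → FieldOneTwo` of the skeleton
`wan_tame_bdp_road` v23, literally): GIVEN `hE : w(E^{(2ℓ)}) = w(E)` for NON-SPLIT multiplicative `2`, `ℓ ≡ 1 (mod 8)` good `≥ 5`,
`(2ℓ/r) = 1` at the odd bad `r` (= `EngineTwo`), for every `E / ℚ` (globally minimal `W`, modular, odd additive primes of quadratic-twist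
type, NON-SPLIT multiplicative at `2`) with `w(E) = −1`, every odd prime `p` and bound `B` there is an imaginary quadratic `K` with
`|d_K| > B`, `2 ∣ d_K`, every odd prime of `N_E` split, `p` split (`SatisfiesHeegnerHypothesis p K`) and `L(E^{(d_K)}, 1) ≠ 0`. Road:
Dirichlet prime `ℓ₁` (§1); `w(E^{(2ℓ₁)}) = −1` by `hE`; Hoffstein–Luo with the sign obstruction on `E^{(2ℓ₁)}`; `d_K = 8ℓ₁d` through the
EVEN branch of `exists_heegnerField_iff_exists_fundamental` at the odd level `p·∏_{r ∣ N_E odd} r`; `E^{(8ℓ₁d)} ≅ E^{(2ℓ₁d)}`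
(`exists_variableChange_quadraticTwist_mul_sq`, `entireLFunction_smul`). [cite: HoffsteinLuo1997, Theorem (§1, pp. 435–436)]
[cite: FriedbergHoffstein1995, Thm. B] [cite: CastellaWan2023, proof of Thm. 6.11 (MS p. 33) (a)–(e)] -/
theorem fieldOneTwo_of_engineTwo
    (hE : ∀ (W : WeierstrassCurve ℚ) [W.IsElliptic] [W.IsGloballyMinimal], exists_isNewformOf →
      (∀ r : Nat.Primes, (r : ℕ) ≠ 2 → W.HasAdditiveReductionAt ((primesEquiv (R := ℤ)).symm r) →
        ¬ (W.quadraticTwist (((-1 : ℤ) ^ ((r : ℕ) / 2) * r : ℤ) : ℚ)).HasAdditiveReductionAt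
          ((primesEquiv (R := ℤ)).symm r)) →
      W.HasMultiplicativeReductionAtPrime 2 → ¬ W.HasSplitMultiplicativeReductionAtPrime 2 →
      ∀ (ℓ : ℕ) [Fact ℓ.Prime], 5 ≤ ℓ → W.HasGoodReductionAtPrime ℓ → (ℓ : ℤ) % 8 = 1 →
        (∀ r : ℕ, r.Prime → r ∣ W.conductorNorm ℤ → r ≠ 2 → jacobiSym ((2 : ℤ) * ℓ) r = 1) →
        (W.quadraticTwist (((2 : ℤ) * ℓ : ℤ) : ℚ)).rootNumber = W.rootNumber) :
    ∀ (W : WeierstrassCurve ℚ) [W.IsElliptic] [W.IsGloballyMinimal], exists_isNewformOf →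
    Literature.NumberTheory.EllipticCurves.HoffsteinLuo1997_exists_twist_L_one_ne_zero →
    (∀ r : Nat.Primes, (r : ℕ) ≠ 2 → W.HasAdditiveReductionAt ((primesEquiv (R := ℤ)).symm r) →
      ¬ (W.quadraticTwist (((-1 : ℤ) ^ ((r : ℕ) / 2) * r : ℤ) : ℚ)).HasAdditiveReductionAt
        ((primesEquiv (R := ℤ)).symm r)) →
    W.rootNumber = -1 → W.HasMultiplicativeReductionAtPrime 2 → ¬ W.HasSplitMultiplicativeReductionAtPrime 2 →
    ∀ (p : ℕ), p.Prime → p ≠ 2 → ∀ B : ℕ,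
      ∃ (K : Type) (_ : Field K) (_ : NumberField K),
        IsImaginaryQuadratic K ∧ B < (NumberField.discr K).natAbs ∧ (2 : ℤ) ∣ NumberField.discr K ∧
          (∀ ℓ : ℕ, ℓ.Prime → ℓ ∣ W.conductorNorm ℤ → ℓ ≠ 2 →
            ((Ideal.span {(ℓ : ℤ)}).primesOver (𝓞 K)).ncard = 2) ∧
          SatisfiesHeegnerHypothesis p K ∧
          (W.quadraticTwist (NumberField.discr K : ℚ)).entireLFunction 1 ≠ 0 := by
  intro W _ _ hmod hHL htt hw h2m h2ns p hp hp2 B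
  set N := W.conductorNorm ℤ with hN
  have hN0 : N ≠ 0 := (W.conductorNorm_pos_holds).ne'
  -- §1: the auxiliary prime `ℓ ≡ 1 (mod 8)`, `(2ℓ / r) = 1` at `r ∈ {p} ∪ {r ∣ N odd}`
  obtain ⟨ℓ, hℓ, hℓB, h8, hjac₀⟩ :=
    exists_prime_emod_eight_eq_one_jacobiSym_two_mul_eq_one (N.primeFactors ∪ {p}) (N + p + 5)
  haveI := Fact.mk hℓ
  have hℓp : ℓ ≠ p := by omega
  have hℓ2 : ℓ ≠ 2 := by omega
  have hℓN : ¬ ℓ ∣ N := fun h ↦ by have := Nat.le_of_dvd (Nat.pos_of_ne_zero hN0) h; omega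
  have hℓg : W.HasGoodReductionAtPrime ℓ := by
    by_contra h; exact hℓN ((W.dvd_conductorNorm_iff_not_hasGoodReductionAtPrime ℓ).mpr h)
  have hjacN : ∀ r : ℕ, r.Prime → r ∣ N → r ≠ 2 → jacobiSym ((2 : ℤ) * ℓ) r = 1 :=
    fun r hr hrN hr2 ↦ hjac₀ r (Finset.mem_union_left _ (Nat.mem_primeFactors.mpr ⟨hr, hrN, hN0⟩)) hr hr2
  have hjacp : jacobiSym ((2 : ℤ) * ℓ) p = 1 := hjac₀ p (by simp) hp hp2
  -- the engine: `w(E^{(2ℓ)}) = w(E) = -1`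
  set d₀ : ℤ := (2 : ℤ) * ℓ with hd₀
  have hd₀ne : d₀ ≠ 0 := mul_ne_zero two_ne_zero (by exact_mod_cast hℓ.ne_zero)
  have hd₀0 : (d₀ : ℚ) ≠ 0 := by exact_mod_cast hd₀ne
  haveI := W.isElliptic_quadraticTwist hd₀0
  have hw₀ : (W.quadraticTwist (d₀ : ℚ)).rootNumber = -1 := by
    rw [hd₀, hE W hmod htt h2m h2ns ℓ (by omega) hℓg h8 hjacN]; exact hw
  -- Hoffstein–Luo for `E₀ = E^{(2ℓ)}`, sign forced negative
  obtain ⟨d, hdneg, hsq, hd8, hBd, hjacS, -, hL⟩ :=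
    exists_neg_fundamental_twist_ne_zero_of_hoffsteinLuo hmod hHL (W.quadraticTwist (d₀ : ℚ)) hw₀
      (N.primeFactors ∪ {p, ℓ}) B
  have hdℓ : jacobiSym d ℓ = 1 := hjacS ℓ (by simp) hℓ hℓ2
  have hdp : jacobiSym d p = 1 := hjacS p (by simp) hp hp2
  have hdN : ∀ r : ℕ, r.Prime → r ∣ N → r ≠ 2 → jacobiSym d r = 1 :=
    fun r hr hrN hr2 ↦ hjacS r (Finset.mem_union_left _ (Nat.mem_primeFactors.mpr ⟨hr, hrN, hN0⟩)) hr hr2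
  -- the composite discriminant `D = 8ℓd = 4·(2ℓd)`, fundamental of the even kind
  set m : ℤ := d₀ * d with hm
  set D : ℤ := 4 * m with hD
  have hd₀pos : 0 < d₀ := mul_pos two_pos (by exact_mod_cast hℓ.pos)
  have hmneg : m < 0 := mul_neg_of_pos_of_neg hd₀pos hdneg
  have hDneg : D < 0 := by rw [hD]; linarith
  have hℓodd : (ℓ : ℤ) % 2 = 1 := by omega
  have hm4 : m % 4 = 2 := by
    have hdodd : d % 2 = 1 := by omega
    have hℓd : ((ℓ : ℤ) * d) % 2 = 1 := by rw [Int.mul_emod, hℓodd, hdodd]; norm_num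
    have hm' : m = 2 * ((ℓ : ℤ) * d) := by rw [hm, hd₀]; ring
    rw [hm']
    omega
  have hcdℓ : IsCoprime d (ℓ : ℤ) := isCoprime_of_jacobiSym_eq_one' hℓ.ne_zero hdℓ
  have hcd2 : IsCoprime (2 : ℤ) d := ⟨-(4 * (d / 8)), 1, by omega⟩
  have hc2ℓ : IsCoprime (2 : ℤ) (ℓ : ℤ) := by
    rw [show (2 : ℤ) = ((2 : ℕ) : ℤ) by rfl, Int.isCoprime_iff_gcd_eq_one, Int.gcd_natCast_natCast]
    exact (Nat.coprime_primes Nat.prime_two hℓ).mpr hℓ2.symm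
  have hsq₀ : Squarefree d₀ := by
    rw [hd₀]
    exact squarefree_mul_iff.mpr ⟨hc2ℓ.isRelPrime, Int.prime_two.squarefree, (Nat.prime_iff_prime_int.mp hℓ).squarefree⟩
  have hsqm : Squarefree m := by
    rw [hm]
    refine squarefree_mul_iff.mpr ⟨?_, hsq₀, hsq⟩
    rw [hd₀]
    exact (hcd2.mul_left hcdℓ.symm).isRelPrime
  have h4D : (4 : ℤ) ∣ D := ⟨m, by rw [hD]⟩
  have hD4 : D / 4 = m := by rw [hD, Int.mul_ediv_cancel_left _ (by norm_num : (4 : ℤ) ≠ 0)]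
  have hBD : B < D.natAbs := by
    have h1 : d.natAbs ≤ m.natAbs := by
      rw [hm, Int.natAbs_mul]
      exact Nat.le_mul_of_pos_left _ (Int.natAbs_pos.mpr hd₀ne)
    have h2 : D.natAbs = 4 * m.natAbs := by
      rw [hD, Int.natAbs_mul, show (4 : ℤ).natAbs = 4 from rfl]
    omega
  -- the Kronecker conditions at the primes of the ODD level `N₁ = p · ∏_{r ∣ N odd} r`
  set M : ℕ := ∏ i ∈ N.primeFactors.erase 2, i with hM
  set N₁ : ℕ := p * M with hN₁
  have hkr : ∀ r : ℕ, r.Prime → r ∣ N₁ → (r = 2 → D % 8 = 1) ∧ (r ≠ 2 → jacobiSym D r = 1) := by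
    intro r hr hrN₁
    -- `r` is odd, with `(2ℓ/r) = 1` and `(d/r) = 1`
    have hj : r ≠ 2 ∧ jacobiSym ((2 : ℤ) * ℓ) r = 1 ∧ jacobiSym d r = 1 := by
      rcases (Nat.Prime.dvd_mul hr).mp hrN₁ with hrp | hrM
      · have hrp' : r = p := (Nat.prime_dvd_prime_iff_eq hr hp).mp hrp
        subst hrp'
        exact ⟨hp2, hjacp, hdp⟩
      · obtain ⟨hrN, hr2⟩ := mem_of_dvd_prod_primeFactors_erase_two hr hrM
        exact ⟨hr2, hjacN r hr hrN hr2, hdN r hr hrN hr2⟩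
    obtain ⟨hr2, hj₁, hj₂⟩ := hj
    refine ⟨fun h ↦ absurd h hr2, fun _ ↦ ?_⟩
    haveI := Fact.mk hr
    have hgcd : Int.gcd (2 : ℤ) r = 1 := by
      rw [show (2 : ℤ) = ((2 : ℕ) : ℤ) by rfl, Int.gcd_natCast_natCast]
      exact (Nat.coprime_primes Nat.prime_two hr).mpr (Ne.symm hr2)
    have h4 : jacobiSym 4 r = 1 := by
      rw [show (4 : ℤ) = 2 * 2 by norm_num, jacobiSym.mul_left, ← sq, jacobiSym.sq_one hgcd]
    rw [hD, hm, hd₀, jacobiSym.mul_left, jacobiSym.mul_left, h4, hj₁, hj₂, mul_one, mul_one]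
  -- `P(D)`: `2 ∣ D` and `L(E^{(D)}, 1) = L(E₀^{(d)}, 1) ≠ 0`
  have h2D : (2 : ℤ) ∣ D := ⟨2 * m, by rw [hD]; ring⟩
  have hLD : (W.quadraticTwist (D : ℚ)).entireLFunction 1 ≠ 0 := by
    obtain ⟨C, hC⟩ := W.exists_variableChange_quadraticTwist_mul_sq (m : ℚ) 2 two_ne_zero
    have hDm : (D : ℚ) = (m : ℚ) * 2 ^ 2 := by rw [hD]; push_cast; ring
    haveI := W.isElliptic_quadraticTwist (show (m : ℚ) ≠ 0 by exact_mod_cast hmneg.ne)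
    rw [hDm, ← hC, entireLFunction_smul, hm, Int.cast_mul, ← quadraticTwist_quadraticTwist]
    exact hL
  -- the dictionary
  obtain ⟨K, iF, iN, hK, hB, hH, h2K, hLK⟩ :=
    (exists_heegnerField_iff_exists_fundamental N₁ B
      (fun D ↦ (2 : ℤ) ∣ D ∧ (W.quadraticTwist (D : ℚ)).entireLFunction 1 ≠ 0)).mpr
      ⟨D, hDneg, Or.inr ⟨h4D, by rw [hD4]; exact Or.inl hm4, by rw [hD4]; exact hsqm⟩, hBD, hkr, h2D, hLD⟩
  have hpN₁ : p ∣ N₁ := ⟨M, by rw [hN₁]⟩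
  refine ⟨K, iF, iN, hK, hB, h2K, fun r hr hrN hr2 ↦ ?_, hH.of_dvd hpN₁, hLK⟩
  exact hH r hr ((dvd_prod_primeFactors_erase_two hN0 hr hrN hr2).trans ⟨p, by rw [hN₁]; ring⟩)

end Summit.BirchSwinnertonDyer.BirchSwinnertonDyer.Theorems.TwistRootNumberDyadic

end
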